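import Summits.HodgeConjecture.HodgeConjecture.Theorems.HeckePrymWeilHyperbolicEightfoldsSqrtMinus7OfAnchorObjectBS
import Literature.AlgebraicGeometry.HodgeTheory.CrossProductTopClass
import HarnessLib

/-!
# The v3 anchor object implies the v4 anchor object (typing certificate of the Brauer–Severi reshape)
# (crux `HeckePrymWeil.HyperbolicEightfoldsSqrtMinus7`, item stmt-HodgeConjecture-14642, route HeckePrymWeil)

Line `euler-squeeze-rank-two-secant-bundle`, skeleton v4.1 (lead c12): `SecantAnchorObject47 → SecantAnchorObjectBS 4 7` with both
statements unfolded — an untwisted semiregular charged sheaf ON the abelian anchor is the degenerate case `U = S`, `g = 𝟙`, `𝒬 = 𝒳`,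
`π = f`, `p = 𝟙`, `m = 0`, `Λ = 0`, `V = S` of an anchor object on a Brauer–Severi family (the double sum collapses to its `(i, j) = (k, 0)`
term and the charge sits in `r₀`).  So nothing provable against the v3 registration is lost by the v4 reshape, and the v4 statement is
satisfiable relative to v3 (no typing artefact makes it vacuous).  [cite: Markman2025SecantWeil, §7.5.2 Step 1]
-/

noncomputable section

-- single-problem summit (Problem = Summit): the mandated namespace repeats `HodgeConjecture`.
set_option linter.dupNamespace false

open CategoryTheory AlgebraicGeometry Limits MonoidalCategory CartesianMonoidalCategory
open Literature.AlgebraicGeometry Literature.AlgebraicGeometry.Motives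
  Literature.AlgebraicGeometry.HodgeTheory
open Literature.AlgebraicTopology.SingularHomology

namespace Summit.HodgeConjecture.HodgeConjecture.Theorems.HyperbolicEightfoldsSqrtMinus7.AnchorObjectBS

/-- **`SecantAnchorObject47 → SecantAnchorObjectBS 4 7`** (both unfolded): the v3 object on the abelian anchor is the case `m = 0`,
`𝒬 = 𝒳`, `Λ = 0` of the v4 object. [cite: Markman2025SecantWeil, §7.5.2 Step 1] -/
theorem anchorObjectBS_of_anchorObject47 :
    (∃ (P : AbelianVariety ℂ) (ψ : P ⟶ P) (e : ProjectiveEmbedding P.X)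
      (a : complexBetti (projectiveSpace e.n ℂ) 2) (w : complexBetti P.X (2 * 4)),
      P.dim = 2 * 4 ∧ ψ ≫ ψ = -((7 : ℤ) • 𝟙 P) ∧ IsRationalClass a ∧ a ≠ 0 ∧
      IsHyperbolicWeilType P ψ 4
        ((7 : ℂ) • complexBetti.map e.ι 2 a + complexBetti.map ψ.hom.hom.hom 2 (complexBetti.map e.ι 2 a)) ∧
      w ∈ weilClassesOf P ψ 4 7 ∧ IsRationalClass w ∧ w ≠ 0 ∧
      ∀ (F₀ : SchemeOver ℂ) (e₀ : P.X ≅ F₀) (C : StandardChernCharacterBetti),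
        ∃ (E₀ : F₀.left.Modules) (hE₀ : IsFiniteLocallyFree E₀) (q : ℕ → ℚ) (r : ℚ), r ≠ 0 ∧
          IsISemiregular hE₀ Set.univ ∧
          (∀ k : ℕ, k ≠ 4 →
            C.ch F₀ E₀ k = ((q k : ℚ) : ℂ) • complexBetti.map e₀.inv (2 * k)
              (cupPowTwo ((7 : ℂ) • complexBetti.map e.ι 2 a +
                complexBetti.map ψ.hom.hom.hom 2 (complexBetti.map e.ι 2 a)) k)) ∧
          C.ch F₀ E₀ 4 = complexBetti.map e₀.inv (2 * 4)
            (((q 4 : ℚ) : ℂ) • cupPowTwo ((7 : ℂ) • complexBetti.map e.ι 2 a +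
                complexBetti.map ψ.hom.hom.hom 2 (complexBetti.map e.ι 2 a)) 4 + ((r : ℚ) : ℂ) • w)) →
    ∃ (P : AbelianVariety ℂ) (ψ : P ⟶ P) (e : ProjectiveEmbedding P.X)
      (a : complexBetti (projectiveSpace e.n ℂ) 2) (w : complexBetti P.X (2 * 4)),
      P.dim = 2 * 4 ∧ ψ ≫ ψ = -((7 : ℕ) • 𝟙 P) ∧ IsRationalClass a ∧ a ≠ 0 ∧
      IsHyperbolicWeilType P ψ 4
        (((7 : ℕ) : ℂ) • complexBetti.map e.ι 2 a + complexBetti.map ψ.hom.hom.hom 2 (complexBetti.map e.ι 2 a)) ∧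
      w ∈ weilClassesOf P ψ 4 7 ∧ IsRationalClass w ∧ w ≠ 0 ∧
      ∀ (𝒳 S : SchemeOver ℂ) (f : 𝒳 ⟶ S) (s₀ : ComplexPoints S) (e' : P.X ≅ fiberOver f s₀),
        IsSmoothProjectiveFamily f (2 * 4) →
        (∃ (N : ℕ) (ι : 𝒳 ⟶ MonoidalCategoryStruct.tensorObj (projectiveSpace N ℂ) S),
          IsClosedImmersion ι.left ∧ ι ≫ CartesianMonoidalCategory.snd (projectiveSpace N ℂ) S = f) →
        IrreducibleSpace S.left → AlgebraicGeometry.Smooth S.hom → IsQuasiProjectiveOver S →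
        (∀ s : ComplexPoints S, ∃ (A'' : AbelianVariety ℂ) (φ'' : A'' ⟶ A''),
          A''.dim = 2 * 4 ∧ φ'' ≫ φ'' = -((7 : ℕ) • 𝟙 A'') ∧ Nonempty (A''.X ≅ fiberOver f s)) →
        ∃ (U 𝒬 : SchemeOver ℂ) (g : U ⟶ S) (π : 𝒬 ⟶ U) (p : 𝒬 ⟶ 𝒳) (m : ℕ) (u₀ : ComplexPoints U)
          (p₀ : fiberOver π u₀ ⟶ fiberOver f s₀) (Λ : complexBetti 𝒬 2) (V : Set S.left),
          AlgebraicGeometry.Smooth U.hom ∧ IrreducibleSpace U.left ∧ IsQuasiProjectiveOver U ∧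
          IsSmoothProjectiveFamily π (2 * 4 + m) ∧ p ≫ f = π ≫ g ∧ u₀ ≫ g = s₀ ∧
          p₀ ≫ fiberι f s₀ = fiberι π u₀ ≫ p ∧
          IsOpen V ∧ V.Nonempty ∧ (∀ t : ComplexPoints S, t.pt ∈ V → ∃ u : ComplexPoints U, u ≫ g = t) ∧
          (∀ u : ComplexPoints U,
            IsRationalClass (complexBetti.map (fiberι π u) 2 Λ) ∧
            IsOfHodgeType (2 * 4 + m) (fiberOver π u) 2 1 1 (complexBetti.map (fiberι π u) 2 Λ) ∧
            (∀ j : ℕ, cupPowTwo (complexBetti.map (fiberι π u) 2 Λ) j ∈ algebraicClasses (fiberOver π u) j) ∧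
            ∃ pu : fiberOver π u ⟶ fiberOver f (u ≫ g),
              pu ≫ fiberι f (u ≫ g) = fiberι π u ≫ p ∧ Function.Surjective pu.left.base ∧
              ∃ y : complexBetti (fiberOver f (u ≫ g)) (2 * (2 * 4)),
                cupProduct (show 2 * (2 * 4) + 2 * m = 2 * (2 * 4 + m) by omega)
                  (complexBetti.map pu (2 * (2 * 4)) y) (cupPowTwo (complexBetti.map (fiberι π u) 2 Λ) m) ≠ 0) ∧
          ∀ C : StandardChernCharacterBetti,
            ∃ (E₀ : (fiberOver π u₀).left.Modules) (hE₀ : IsFiniteLocallyFree E₀) (c : ℕ → ℕ → ℕ → ℚ) (r : ℕ → ℚ),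
              r m ≠ 0 ∧ IsISemiregular hE₀ Set.univ ∧
              ∀ k : ℕ, C.ch (fiberOver π u₀) E₀ k =
                (∑ i ∈ Finset.range (k + 1), ∑ j ∈ Finset.range (k + 1),
                  if hij : i + j = k then
                    ((c k i j : ℚ) : ℂ) • cupProduct (show 2 * i + 2 * j = 2 * k by omega)
                      (complexBetti.map p₀ (2 * i) (complexBetti.map e'.inv (2 * i) (cupPowTwo
                        (((7 : ℕ) : ℂ) • complexBetti.map e.ι 2 a +
                          complexBetti.map ψ.hom.hom.hom 2 (complexBetti.map e.ι 2 a)) i)))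
                      (cupPowTwo (complexBetti.map (fiberι π u₀) 2 Λ) j)
                  else 0) +
                (if hk : 4 ≤ k then
                    ((r (k - 4) : ℚ) : ℂ) • cupProduct (show 2 * 4 + 2 * (k - 4) = 2 * k by omega)
                      (complexBetti.map p₀ (2 * 4) (complexBetti.map e'.inv (2 * 4) w))
                      (cupPowTwo (complexBetti.map (fiberι π u₀) 2 Λ) (k - 4))
                  else 0) := by
  rintro ⟨P, ψ, e, a, w, hP8, hψ, ha, ha0, hhyp, hwW, hwrat, hw0, hobj⟩
  have h7 : ((7 : ℕ) : ℂ) = (7 : ℂ) := Nat.cast_ofNat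
  refine ⟨P, ψ, e, a, w, hP8, ?_, ha, ha0, ?_, hwW, hwrat, hw0, ?_⟩
  · rw [hψ, ← natCast_zsmul]; rfl
  · rw [h7]; exact hhyp
  intro 𝒳 S f s₀ e' hfam _hemb hirr hsm hSqp _habS
  haveI := hirr
  let μ : OrientationFamily := fun _ _ h ↦ Classical.choice (Motives.ComplexPoints.isOrientableOver ℂ h)
  refine ⟨S, 𝒳, 𝟙 S, f, 𝟙 𝒳, 0, s₀, 𝟙 _, 0, Set.univ, hsm, hirr, hSqp, hfam, by simp, by simp, by simp, isOpen_univ,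
    Set.univ_nonempty, fun t _ => ⟨t, Category.comp_id t⟩, ?_, ?_⟩
  · -- the (vacuous) Brauer–Severi data: `Λ = 0`, fibre maps the identity
    intro u
    obtain ⟨M⟩ := nonempty_hodgeModel_holds.nonempty (hfam.isSmoothProjective u)
    refine ⟨by rw [map_zero]; exact IsRationalClass.zero, by rw [map_zero]; exact IsOfHodgeType.zero M _ _ _, ?_, ?_⟩
    · intro j
      cases j with
      | zero => rw [cupPowTwo_zero, algebraicClasses_zero]; exact Submodule.mem_top
      | succ j => rw [map_zero, cupPowTwo_succ, map_zero]; exact Submodule.zero_mem _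
    · rw [Category.comp_id u]
      obtain ⟨y, hy0, -⟩ := exists_isRationalClass_top_ne_zero μ (hfam.isSmoothProjective u)
      refine ⟨𝟙 _, by simp, fun x => ⟨x, rfl⟩, y, ?_⟩
      rw [cupPowTwo_zero, complexBetti.map_id, CategoryTheory.id_apply]
      intro h0
      apply hy0
      rw [← cupProduct_one' (h := show 2 * (2 * 4) + 0 = 2 * (2 * 4) from rfl) (a := y)]
      exact h0
  · -- the object: the v3 sheaf, with the double sum collapsed to `(i, j) = (k, 0)`
    intro C
    obtain ⟨E₀, hE₀, q, r, hr, hsr, hEk, hEn⟩ := hobj (fiberOver f s₀) e' C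
    refine ⟨E₀, hE₀, fun k _ j => if j = 0 then q k else 0, fun j => if j = 0 then r else 0, by simpa using hr, hsr, ?_⟩
    intro k
    -- collapse the double sum
    have hsum : (∑ i ∈ Finset.range (k + 1), ∑ j ∈ Finset.range (k + 1),
        if hij : i + j = k then
          (((if j = 0 then q k else 0 : ℚ) : ℚ) : ℂ) • cupProduct (show 2 * i + 2 * j = 2 * k by omega)
            (complexBetti.map (𝟙 (fiberOver f s₀)) (2 * i) (complexBetti.map e'.inv (2 * i) (cupPowTwo
              (((7 : ℕ) : ℂ) • complexBetti.map e.ι 2 a +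
                complexBetti.map ψ.hom.hom.hom 2 (complexBetti.map e.ι 2 a)) i)))
            (cupPowTwo (complexBetti.map (fiberι f s₀) 2 (0 : complexBetti 𝒳 2)) j)
        else 0) =
        ((q k : ℚ) : ℂ) • complexBetti.map e'.inv (2 * k) (cupPowTwo
          ((7 : ℂ) • complexBetti.map e.ι 2 a + complexBetti.map ψ.hom.hom.hom 2 (complexBetti.map e.ι 2 a)) k) := by
      rw [Finset.sum_eq_single k, Finset.sum_eq_single 0]
      · rw [dif_pos (Nat.add_zero k), if_pos rfl, complexBetti.map_id, CategoryTheory.id_apply, cupPowTwo_zero, h7]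
        congr 1
        exact cupProduct_one' (h := _) (a := _)
      · intro j _ hj
        rw [dif_neg (show ¬ (k + j = k) by omega)]
      · intro hk; exact absurd (Finset.mem_range.2 (Nat.succ_pos k)) hk
      · intro i _ hik
        refine Finset.sum_eq_zero fun j _ => ?_
        by_cases hij : i + j = k
        · rw [dif_pos hij, if_neg (show j ≠ 0 by omega)]
          simp
        · rw [dif_neg hij]
      · intro hk; exact absurd (Finset.self_mem_range_succ k) hk
    rw [hsum]
    by_cases hk4 : k = 4
    · subst hk4
      rw [dif_pos le_rfl, hEn, map_add, map_smul, map_smul]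
      dsimp only [Nat.reduceSub]
      rw [if_pos rfl, cupPowTwo_zero, complexBetti.map_id, CategoryTheory.id_apply, cupProduct_one']
    · rw [hEk k hk4]
      by_cases hk : 4 ≤ k
      · have hk' : k - 4 ≠ 0 := by omega
        rw [dif_pos hk]
        dsimp only
        rw [if_neg hk']
        simp
      · rw [dif_neg hk, add_zero]

end Summit.HodgeConjecture.HodgeConjecture.Theorems.HyperbolicEightfoldsSqrtMinus7.AnchorObjectBS

end
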